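import Summits.CriticalPhenomena.PercolationContinuityZ3.Theorems.PercNearOneGluingNoHeavyLowerTailIncStarTwoPortEvents
import Summits.CriticalPhenomena.PercolationContinuityZ3.Theorems.PercNearOneGluingNoHeavyLowerTailIncStarBranchLemmaStep
import HarnessLib

/-!
# The TWO-PORT branch lemma (H), III: the bridge step when the hanging target is beyond the bridge

Support file for the Sahi programme (`--supports stmt-CriticalPhenomena-4575`, prover prim-sahi-p2 gen 21).  No definitions, no named
facts, no sorries; standard axioms.  Memo `run/shared/lean/prim/prim-sahi/prim-sahi-p2/gen21/THEOREM-H.md` §1 (cases BA, BB).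

Setting of `…IncStarTwoPortEvents` / `…IncStarTwoPortStepNear` (root `s`, ports `u`, `v`, bridge `e = s(v, x')` at `v` with `v`-side
`L ∌ s, x', u`, `w0 = w[e↦0]`).  Here the hanging target `b` lies beyond the bridge (`b ∉ L`), so `U_b` needs the bridge OPEN and
factorises as `{s↛v in A} × U'_b` with the shorter two-port event `U'_b = {s↔u in B} ∩ {s↔x' in B}ᶜ ∩ {b↔x' in B}`:
* `twoPort_step_BA` (`c ∈ L`): from (H)(w0; s, v; v, c) = the branch lemma (Br) on the `v`-side;
* `twoPort_step_BB` (`c ∉ L`): from (H)(w0; u, x'; b, c) and `P(X₃) ≤ P₁(X₃)` (`{s↔c in B} ∪ {u↔c in B} ⊆ … ∪ {x'↔c in B}`).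
-/

noncomputable section

namespace Summit.CriticalPhenomena.PercolationContinuityZ3.Theorems

namespace IncStar

open MeasureTheory Set Literature.Probability.Percolation Literature.Probability.LatticeModels EdgeInduction
open scoped Classical

variable {n : ℕ}

/-- **(H), bridge step, case BA** (`b` beyond the bridge, `c` on the port's side): (Br)(w[e↦0]; v, c) ⟹ (H)(w; u, v; b, c). [this work] -/
theorem twoPort_step_BA (w : Sym2 (Fin n) → unitInterval) (L : Set (Fin n)) {s u v x' b c : Fin n}
    (hsL : s ∉ L) (hvL : v ∈ L) (hxL : x' ∉ L) (huL : u ∉ L) (hbL : b ∉ L) (hcL : c ∈ L)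
    (hcross : ∀ x y : Fin n, x ∈ L → y ∉ L → y ≠ s → s(x, y) ≠ s(v, x') → w s(x, y) = 0)
    (IH : (prodBernoulli (Function.update w s(v, x') 0)).real (openConn s s ∩ (openConn s v)ᶜ ∩ openConn v v) *
        (prodBernoulli (Function.update w s(v, x') 0)).real (openConn s c ∪ openConn s c ∪ openConn v c)
      ≤ (prodBernoulli (Function.update w s(v, x') 0)).real
          (openConn s s ∩ (openConn s v)ᶜ ∩ openConn v v ∩ (openConn s c ∪ openConn s c ∪ openConn v c))
        + (prodBernoulli (Function.update w s(v, x') 0)).real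
          (openConn s s ∩ (openConn s v)ᶜ ∩ openConn v v ∩ (openConn s c ∪ openConn s c))) :
    (prodBernoulli w).real (openConn s u ∩ (openConn s v)ᶜ ∩ openConn b v) *
        (prodBernoulli w).real (openConn s c ∪ openConn u c ∪ openConn v c)
      ≤ (prodBernoulli w).real (openConn s u ∩ (openConn s v)ᶜ ∩ openConn b v ∩ (openConn s c ∪ openConn u c ∪ openConn v c))
        + (prodBernoulli w).real (openConn s u ∩ (openConn s v)ᶜ ∩ openConn b v ∩ (openConn s c ∪ openConn u c)) := by
  -- names
  set e : Sym2 (Fin n) := s(v, x')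
  set w0 := Function.update w e 0 with hw0
  set w1 := Function.update w e 1
  set U : Set (BondConfig (Fin n)) := openConn s u ∩ (openConn s v)ᶜ ∩ openConn b v
  set X3 : Set (BondConfig (Fin n)) := openConn s c ∪ openConn u c ∪ openConn v c
  set X2 : Set (BondConfig (Fin n)) := openConn s c ∪ openConn u c
  set SAv : Set (BondConfig (Fin n)) := openConnIn (insert s L) s v
  set SAc : Set (BondConfig (Fin n)) := openConnIn (insert s L) s c
  set NAvc : Set (BondConfig (Fin n)) := openConnIn (insert s L) v c
  set SBu : Set (BondConfig (Fin n)) := openConnIn Lᶜ s u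
  set SBx : Set (BondConfig (Fin n)) := openConnIn Lᶜ s x'
  set NBbx : Set (BondConfig (Fin n)) := openConnIn Lᶜ b x'
  -- (0) the bridge hypothesis under `w0`, the almost-sure set, independence
  have hsu1 : s ∉ L := hsL
  have hw0cross : ∀ x y : Fin n, x ∈ L → y ∉ L → y ≠ s → w0 s(x, y) = 0 := by
    intro x y hx hy hys
    by_cases hxy : s(x, y) = e
    · rw [hxy, hw0, Function.update_self]
    · rw [hw0, Function.update_of_ne hxy]; exact hcross x y hx hy hys hxy
  set G : Set (BondConfig (Fin n)) := {ω | ∀ e', w0 e' = 0 → e' ∉ ω}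
  have hG1 : (prodBernoulli w0).real G = 1 := real_sureClosed w0
  have hωG : ∀ ω ∈ G, ∀ x y : Fin n, x ∈ L → y ∉ L → y ≠ s → s(x, y) ∉ ω :=
    fun ω hω x y hx hy hys => hω _ (hw0cross x y hx hy hys)
  have hm : ∀ X : Set (BondConfig (Fin n)), MeasurableSet X := fun _ => MeasurableSet.of_discrete
  have hdiff : ∀ {A B : Set (BondConfig (Fin n))} {K' : Set (Sym2 (Fin n))},
      DeterminedBy A K' → DeterminedBy B K' → DeterminedBy (A \ B) K' := by
    intro A B K' hA hB
    rw [determinedBy_iff] at hA hB ⊢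
    intro ω ω' h
    rw [Set.mem_sdiff, Set.mem_sdiff, hA ω ω' h, hB ω ω' h]
  have hinter : ∀ {A B : Set (BondConfig (Fin n))} {K' : Set (Sym2 (Fin n))},
      DeterminedBy A K' → DeterminedBy B K' → DeterminedBy (A ∩ B) K' := by
    intro A B K' hA hB
    rw [determinedBy_iff] at hA hB ⊢
    intro ω ω' h
    rw [Set.mem_inter_iff, Set.mem_inter_iff, hA ω ω' h, hB ω ω' h]
  have hunion : ∀ {A B : Set (BondConfig (Fin n))} {K' : Set (Sym2 (Fin n))},
      DeterminedBy A K' → DeterminedBy B K' → DeterminedBy (A ∪ B) K' := by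
    intro A B K' hA hB
    rw [determinedBy_iff] at hA hB ⊢
    intro ω ω' h
    rw [Set.mem_union, Set.mem_union, hA ω ω' h, hB ω ω' h]
  have hdn : ∀ x y : Fin n, DeterminedBy (openConnIn (insert s L) x y : Set (BondConfig (Fin n)))
      {z : Sym2 (Fin n) | ¬ z.IsDiag ∧ ∀ x ∈ z, x ∈ insert s L} := fun x y => IncStarCutVertex.determinedBy_openConnIn_offDiag _ x y
  have hdf : ∀ x y : Fin n, DeterminedBy (openConnIn Lᶜ x y : Set (BondConfig (Fin n)))
      {z : Sym2 (Fin n) | ¬ z.IsDiag ∧ ∀ x ∈ z, x ∈ Lᶜ} := fun x y => IncStarCutVertex.determinedBy_openConnIn_offDiag _ x y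
  have indep : ∀ {A B : Set (BondConfig (Fin n))}, DeterminedBy A {z : Sym2 (Fin n) | ¬ z.IsDiag ∧ ∀ x ∈ z, x ∈ insert s L} →
      DeterminedBy B {z : Sym2 (Fin n) | ¬ z.IsDiag ∧ ∀ x ∈ z, x ∈ Lᶜ} →
      (prodBernoulli w0).real (A ∩ B) = (prodBernoulli w0).real A * (prodBernoulli w0).real B :=
    fun hA hB => indep_blocks w0 L s hA hB
  -- (1) one-bond decomposition and the lift
  have ob : ∀ A : Set (BondConfig (Fin n)),
      (prodBernoulli w).real A = (1 - (w e : ℝ)) * (prodBernoulli w0).real A + (w e : ℝ) * (prodBernoulli w1).real A := by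
    intro A
    have hA : DeterminedBy A (↑(Finset.univ : Finset (Sym2 (Fin n))) : Set (Sym2 (Fin n))) := by
      rw [determinedBy_iff]
      intro ω ω' h
      rw [Finset.coe_univ, Set.inter_univ, Set.inter_univ] at h
      rw [h]
    exact prodBernoulli_real_oneBond hA w (Finset.mem_univ e)
  have lift : ∀ A : Set (BondConfig (Fin n)),
      (prodBernoulli w1).real A = (prodBernoulli w0).real ((fun ω : BondConfig (Fin n) => insert e ω) ⁻¹' A) :=
    fun A => tieLiftOne_real_one_eq w e A
  have zero_of_empty : ∀ {A : Set (BondConfig (Fin n))}, (∀ ω ∈ G, ω ∉ A) → (prodBernoulli w0).real A = 0 := by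
    intro A h
    rw [real_congr_of_sure hG1 (A' := (∅ : Set (BondConfig (Fin n))))
      (fun ω hω => ⟨fun hA => (h ω hω hA).elim, fun hA => (Set.notMem_empty _ hA).elim⟩), measureReal_empty]
  -- (2) the eight moments in block form
  have hAv : DeterminedBy (Set.univ \ SAv) {z : Sym2 (Fin n) | ¬ z.IsDiag ∧ ∀ x ∈ z, x ∈ insert s L} :=
    hdiff (determinedBy_univ _) (hdn s v)
  have hU'b : DeterminedBy ((SBu \ SBx) ∩ NBbx) {z : Sym2 (Fin n) | ¬ z.IsDiag ∧ ∀ x ∈ z, x ∈ Lᶜ} :=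
    hinter (hdiff (hdf s u) (hdf s x')) (hdf b x')
  have m1 : (prodBernoulli w0).real U = 0 :=
    zero_of_empty fun ω hω => twoPort_mem_U_far L hsL hvL (hωG ω hω) hbL
  have m2 : (prodBernoulli w1).real U = (prodBernoulli w0).real (Set.univ \ SAv) * (prodBernoulli w0).real ((SBu \ SBx) ∩ NBbx) := by
    rw [lift, ← indep hAv hU'b]
    refine real_congr_of_sure hG1 fun ω hω => ?_
    rw [Set.mem_preimage, twoPort_lift_U_far L hsL hvL hxL huL (hωG ω hω) hbL]
    simp only [Set.mem_inter_iff, Set.mem_sdiff, Set.mem_univ, true_and]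
    exact Iff.rfl
  have m3 : (prodBernoulli w0).real X3 = (prodBernoulli w0).real (SAc ∪ NAvc) :=
    real_congr_of_sure hG1 fun ω hω => by rw [twoPort_mem_X3_near L hsL hvL huL (hωG ω hω) hcL, Set.mem_union]
  have m4 : (prodBernoulli w1).real X3 = (prodBernoulli w0).real (SAc ∪ NAvc) := by
    rw [lift]
    exact real_congr_of_sure hG1 fun ω hω => by
      rw [Set.mem_preimage, twoPort_lift_X3_near L hsL hvL hxL huL (hωG ω hω) hcL, Set.mem_union]
  have m5 : (prodBernoulli w0).real (U ∩ X3) = 0 :=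
    zero_of_empty fun ω hω h => twoPort_mem_U_far L hsL hvL (hωG ω hω) hbL h.1
  have m6 : (prodBernoulli w1).real (U ∩ X3)
      = (prodBernoulli w0).real ((SAc ∪ NAvc) \ SAv) * (prodBernoulli w0).real ((SBu \ SBx) ∩ NBbx) := by
    rw [lift, ← indep (hdiff (hunion (hdn s c) (hdn v c)) (hdn s v)) hU'b]
    refine real_congr_of_sure hG1 fun ω hω => ?_
    rw [Set.mem_preimage, Set.mem_inter_iff, twoPort_lift_U_far L hsL hvL hxL huL (hωG ω hω) hbL,
      twoPort_lift_X3_near L hsL hvL hxL huL (hωG ω hω) hcL]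
    simp only [Set.mem_inter_iff, Set.mem_sdiff, Set.mem_union]
    tauto
  have m7 : (prodBernoulli w0).real (U ∩ X2) = 0 :=
    zero_of_empty fun ω hω h => twoPort_mem_U_far L hsL hvL (hωG ω hω) hbL h.1
  have m8 : (prodBernoulli w1).real (U ∩ X2)
      = (prodBernoulli w0).real (SAc \ SAv) * (prodBernoulli w0).real ((SBu \ SBx) ∩ NBbx) := by
    rw [lift, ← indep (hdiff (hdn s c) (hdn s v)) hU'b]
    refine real_congr_of_sure hG1 fun ω hω => ?_
    rw [Set.mem_preimage, Set.mem_inter_iff]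
    constructor
    · rintro ⟨hU, hX⟩
      rw [twoPort_lift_X2_near L hsL hvL hxL huL (hωG ω hω) hcL hU] at hX
      rw [twoPort_lift_U_far L hsL hvL hxL huL (hωG ω hω) hbL] at hU
      simp only [Set.mem_inter_iff, Set.mem_sdiff]
      tauto
    · intro h
      simp only [Set.mem_inter_iff, Set.mem_sdiff] at h
      have hU : insert e ω ∈ U := by
        rw [twoPort_lift_U_far L hsL hvL hxL huL (hωG ω hω) hbL]; tauto
      rw [twoPort_lift_X2_near L hsL hvL hxL huL (hωG ω hω) hcL hU]
      exact ⟨hU, h.1.1⟩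
  -- (3) the induction instance `(s, v; v, c)` in block form
  have hss : ∀ ω : BondConfig (Fin n), ω ∈ openConnIn Lᶜ s s := fun ω => ⟨hsL, hsL, SimpleGraph.Reachable.refl _⟩
  have hvv : ∀ ω : BondConfig (Fin n), ω ∈ openConnIn (insert s L) v v := fun ω =>
    ⟨Set.mem_insert_of_mem s hvL, Set.mem_insert_of_mem s hvL, SimpleGraph.Reachable.refl _⟩
  have cU : ∀ ω ∈ G, (ω ∈ openConn s s ∩ (openConn s v)ᶜ ∩ openConn v v ↔ ω ∈ Set.univ \ SAv) := fun ω hω => by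
    rw [twoPort_mem_U_near L hsL hvL hsu1 (hωG ω hω) hvL, Set.mem_sdiff]
    have h1 := hss ω
    have h2 := hvv ω
    simp only [Set.mem_univ, true_and]
    tauto
  have i1 : (prodBernoulli w0).real (openConn s s ∩ (openConn s v)ᶜ ∩ openConn v v) = (prodBernoulli w0).real (Set.univ \ SAv) :=
    real_congr_of_sure hG1 cU
  have i2 : (prodBernoulli w0).real (openConn s c ∪ openConn s c ∪ openConn v c) = (prodBernoulli w0).real (SAc ∪ NAvc) :=
    real_congr_of_sure hG1 fun ω hω => by rw [twoPort_mem_X3_near L hsL hvL hsu1 (hωG ω hω) hcL, Set.mem_union]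
  have i3 : (prodBernoulli w0).real (openConn s s ∩ (openConn s v)ᶜ ∩ openConn v v ∩ (openConn s c ∪ openConn s c ∪ openConn v c))
      = (prodBernoulli w0).real ((SAc ∪ NAvc) \ SAv) :=
    real_congr_of_sure hG1 fun ω hω => by
      rw [Set.mem_inter_iff, cU ω hω, twoPort_mem_X3_near L hsL hvL hsu1 (hωG ω hω) hcL]
      simp only [Set.mem_sdiff, Set.mem_union, Set.mem_univ, true_and]
      tauto
  have i4 : (prodBernoulli w0).real (openConn s s ∩ (openConn s v)ᶜ ∩ openConn v v ∩ (openConn s c ∪ openConn s c))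
      = (prodBernoulli w0).real (SAc \ SAv) :=
    real_congr_of_sure hG1 fun ω hω => by
      rw [Set.mem_inter_iff, cU ω hω, twoPort_X2_near L hsL hsu1 (hωG ω hω) hcL]
      simp only [Set.mem_sdiff, Set.mem_univ, true_and]
      tauto
  have IH' := IH
  rw [i1, i2, i3, i4] at IH'
  -- (4) assemble: `p·U'·(A′·Z) ≤ p·U'·(Z∖A + S∖A)`
  rw [ob U, ob X3, ob (U ∩ X3), ob (U ∩ X2), m1, m2, m3, m4, m5, m6, m7, m8]
  have hp0 : (0 : ℝ) ≤ w e := (w e).2.1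
  have hUb : 0 ≤ (prodBernoulli w0).real ((SBu \ SBx) ∩ NBbx) := measureReal_nonneg
  have key := mul_le_mul_of_nonneg_left IH' (mul_nonneg hp0 hUb)
  have e1 : ((1 - (w e : ℝ)) * 0 + (w e : ℝ) * ((prodBernoulli w0).real (Set.univ \ SAv) * (prodBernoulli w0).real ((SBu \ SBx) ∩ NBbx)))
      * ((1 - (w e : ℝ)) * (prodBernoulli w0).real (SAc ∪ NAvc) + (w e : ℝ) * (prodBernoulli w0).real (SAc ∪ NAvc))
      = (w e : ℝ) * (prodBernoulli w0).real ((SBu \ SBx) ∩ NBbx)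
        * ((prodBernoulli w0).real (Set.univ \ SAv) * (prodBernoulli w0).real (SAc ∪ NAvc)) := by ring
  have e2 : ((1 - (w e : ℝ)) * 0
        + (w e : ℝ) * ((prodBernoulli w0).real ((SAc ∪ NAvc) \ SAv) * (prodBernoulli w0).real ((SBu \ SBx) ∩ NBbx)))
      + ((1 - (w e : ℝ)) * 0 + (w e : ℝ) * ((prodBernoulli w0).real (SAc \ SAv) * (prodBernoulli w0).real ((SBu \ SBx) ∩ NBbx)))
      = (w e : ℝ) * (prodBernoulli w0).real ((SBu \ SBx) ∩ NBbx)
        * ((prodBernoulli w0).real ((SAc ∪ NAvc) \ SAv) + (prodBernoulli w0).real (SAc \ SAv)) := by ring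
  rw [e1, e2]
  exact key

/-- **(H), bridge step, case BB** (`b, c` beyond the bridge): (H)(w[e↦0]; u, x'; b, c) ⟹ (H)(w; u, v; b, c). [this work] -/
theorem twoPort_step_BB (w : Sym2 (Fin n) → unitInterval) (L : Set (Fin n)) {s u v x' b c : Fin n}
    (hsL : s ∉ L) (hvL : v ∈ L) (hxL : x' ∉ L) (huL : u ∉ L) (hbL : b ∉ L) (hcL : c ∉ L)
    (hcross : ∀ x y : Fin n, x ∈ L → y ∉ L → y ≠ s → s(x, y) ≠ s(v, x') → w s(x, y) = 0)
    (IH : (prodBernoulli (Function.update w s(v, x') 0)).real (openConn s u ∩ (openConn s x')ᶜ ∩ openConn b x') *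
        (prodBernoulli (Function.update w s(v, x') 0)).real (openConn s c ∪ openConn u c ∪ openConn x' c)
      ≤ (prodBernoulli (Function.update w s(v, x') 0)).real
          (openConn s u ∩ (openConn s x')ᶜ ∩ openConn b x' ∩ (openConn s c ∪ openConn u c ∪ openConn x' c))
        + (prodBernoulli (Function.update w s(v, x') 0)).real
          (openConn s u ∩ (openConn s x')ᶜ ∩ openConn b x' ∩ (openConn s c ∪ openConn u c))) :
    (prodBernoulli w).real (openConn s u ∩ (openConn s v)ᶜ ∩ openConn b v) *
        (prodBernoulli w).real (openConn s c ∪ openConn u c ∪ openConn v c)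
      ≤ (prodBernoulli w).real (openConn s u ∩ (openConn s v)ᶜ ∩ openConn b v ∩ (openConn s c ∪ openConn u c ∪ openConn v c))
        + (prodBernoulli w).real (openConn s u ∩ (openConn s v)ᶜ ∩ openConn b v ∩ (openConn s c ∪ openConn u c)) := by
  -- names
  set e : Sym2 (Fin n) := s(v, x')
  set w0 := Function.update w e 0 with hw0
  set w1 := Function.update w e 1
  set U : Set (BondConfig (Fin n)) := openConn s u ∩ (openConn s v)ᶜ ∩ openConn b v
  set X3 : Set (BondConfig (Fin n)) := openConn s c ∪ openConn u c ∪ openConn v c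
  set X2 : Set (BondConfig (Fin n)) := openConn s c ∪ openConn u c
  set SAv : Set (BondConfig (Fin n)) := openConnIn (insert s L) s v
  set SBu : Set (BondConfig (Fin n)) := openConnIn Lᶜ s u
  set SBx : Set (BondConfig (Fin n)) := openConnIn Lᶜ s x'
  set SBc : Set (BondConfig (Fin n)) := openConnIn Lᶜ s c
  set NBuc : Set (BondConfig (Fin n)) := openConnIn Lᶜ u c
  set NBxc : Set (BondConfig (Fin n)) := openConnIn Lᶜ x' c
  set NBbx : Set (BondConfig (Fin n)) := openConnIn Lᶜ b x'
  -- (0) the bridge hypothesis under `w0`, the almost-sure set, independence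
  have hw0cross : ∀ x y : Fin n, x ∈ L → y ∉ L → y ≠ s → w0 s(x, y) = 0 := by
    intro x y hx hy hys
    by_cases hxy : s(x, y) = e
    · rw [hxy, hw0, Function.update_self]
    · rw [hw0, Function.update_of_ne hxy]; exact hcross x y hx hy hys hxy
  set G : Set (BondConfig (Fin n)) := {ω | ∀ e', w0 e' = 0 → e' ∉ ω}
  have hG1 : (prodBernoulli w0).real G = 1 := real_sureClosed w0
  have hωG : ∀ ω ∈ G, ∀ x y : Fin n, x ∈ L → y ∉ L → y ≠ s → s(x, y) ∉ ω :=
    fun ω hω x y hx hy hys => hω _ (hw0cross x y hx hy hys)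
  have hm : ∀ X : Set (BondConfig (Fin n)), MeasurableSet X := fun _ => MeasurableSet.of_discrete
  have hdiff : ∀ {A B : Set (BondConfig (Fin n))} {K' : Set (Sym2 (Fin n))},
      DeterminedBy A K' → DeterminedBy B K' → DeterminedBy (A \ B) K' := by
    intro A B K' hA hB
    rw [determinedBy_iff] at hA hB ⊢
    intro ω ω' h
    rw [Set.mem_sdiff, Set.mem_sdiff, hA ω ω' h, hB ω ω' h]
  have hinter : ∀ {A B : Set (BondConfig (Fin n))} {K' : Set (Sym2 (Fin n))},
      DeterminedBy A K' → DeterminedBy B K' → DeterminedBy (A ∩ B) K' := by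
    intro A B K' hA hB
    rw [determinedBy_iff] at hA hB ⊢
    intro ω ω' h
    rw [Set.mem_inter_iff, Set.mem_inter_iff, hA ω ω' h, hB ω ω' h]
  have hunion : ∀ {A B : Set (BondConfig (Fin n))} {K' : Set (Sym2 (Fin n))},
      DeterminedBy A K' → DeterminedBy B K' → DeterminedBy (A ∪ B) K' := by
    intro A B K' hA hB
    rw [determinedBy_iff] at hA hB ⊢
    intro ω ω' h
    rw [Set.mem_union, Set.mem_union, hA ω ω' h, hB ω ω' h]
  have hdn : ∀ x y : Fin n, DeterminedBy (openConnIn (insert s L) x y : Set (BondConfig (Fin n)))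
      {z : Sym2 (Fin n) | ¬ z.IsDiag ∧ ∀ x ∈ z, x ∈ insert s L} := fun x y => IncStarCutVertex.determinedBy_openConnIn_offDiag _ x y
  have hdf : ∀ x y : Fin n, DeterminedBy (openConnIn Lᶜ x y : Set (BondConfig (Fin n)))
      {z : Sym2 (Fin n) | ¬ z.IsDiag ∧ ∀ x ∈ z, x ∈ Lᶜ} := fun x y => IncStarCutVertex.determinedBy_openConnIn_offDiag _ x y
  have indep : ∀ {A B : Set (BondConfig (Fin n))}, DeterminedBy A {z : Sym2 (Fin n) | ¬ z.IsDiag ∧ ∀ x ∈ z, x ∈ insert s L} →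
      DeterminedBy B {z : Sym2 (Fin n) | ¬ z.IsDiag ∧ ∀ x ∈ z, x ∈ Lᶜ} →
      (prodBernoulli w0).real (A ∩ B) = (prodBernoulli w0).real A * (prodBernoulli w0).real B :=
    fun hA hB => indep_blocks w0 L s hA hB
  -- (1) one-bond decomposition and the lift
  have ob : ∀ A : Set (BondConfig (Fin n)),
      (prodBernoulli w).real A = (1 - (w e : ℝ)) * (prodBernoulli w0).real A + (w e : ℝ) * (prodBernoulli w1).real A := by
    intro A
    have hA : DeterminedBy A (↑(Finset.univ : Finset (Sym2 (Fin n))) : Set (Sym2 (Fin n))) := by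
      rw [determinedBy_iff]
      intro ω ω' h
      rw [Finset.coe_univ, Set.inter_univ, Set.inter_univ] at h
      rw [h]
    exact prodBernoulli_real_oneBond hA w (Finset.mem_univ e)
  have lift : ∀ A : Set (BondConfig (Fin n)),
      (prodBernoulli w1).real A = (prodBernoulli w0).real ((fun ω : BondConfig (Fin n) => insert e ω) ⁻¹' A) :=
    fun A => tieLiftOne_real_one_eq w e A
  have zero_of_empty : ∀ {A : Set (BondConfig (Fin n))}, (∀ ω ∈ G, ω ∉ A) → (prodBernoulli w0).real A = 0 := by
    intro A h
    rw [real_congr_of_sure hG1 (A' := (∅ : Set (BondConfig (Fin n))))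
      (fun ω hω => ⟨fun hA => (h ω hω hA).elim, fun hA => (Set.notMem_empty _ hA).elim⟩), measureReal_empty]
  -- (2) the eight moments in block form
  have hAv : DeterminedBy (Set.univ \ SAv) {z : Sym2 (Fin n) | ¬ z.IsDiag ∧ ∀ x ∈ z, x ∈ insert s L} :=
    hdiff (determinedBy_univ _) (hdn s v)
  have hU'b : DeterminedBy ((SBu \ SBx) ∩ NBbx) {z : Sym2 (Fin n) | ¬ z.IsDiag ∧ ∀ x ∈ z, x ∈ Lᶜ} :=
    hinter (hdiff (hdf s u) (hdf s x')) (hdf b x')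
  have hC0 : DeterminedBy (SBc ∪ NBuc) {z : Sym2 (Fin n) | ¬ z.IsDiag ∧ ∀ x ∈ z, x ∈ Lᶜ} := hunion (hdf s c) (hdf u c)
  have hC1 : DeterminedBy (SBc ∪ NBuc ∪ NBxc) {z : Sym2 (Fin n) | ¬ z.IsDiag ∧ ∀ x ∈ z, x ∈ Lᶜ} := hunion hC0 (hdf x' c)
  have m1 : (prodBernoulli w0).real U = 0 :=
    zero_of_empty fun ω hω => twoPort_mem_U_far L hsL hvL (hωG ω hω) hbL
  have m2 : (prodBernoulli w1).real U = (prodBernoulli w0).real (Set.univ \ SAv) * (prodBernoulli w0).real ((SBu \ SBx) ∩ NBbx) := by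
    rw [lift, ← indep hAv hU'b]
    refine real_congr_of_sure hG1 fun ω hω => ?_
    rw [Set.mem_preimage, twoPort_lift_U_far L hsL hvL hxL huL (hωG ω hω) hbL]
    simp only [Set.mem_inter_iff, Set.mem_sdiff, Set.mem_univ, true_and]
    exact Iff.rfl
  have m3 : (prodBernoulli w0).real X3 = (prodBernoulli w0).real (SBc ∪ NBuc) :=
    real_congr_of_sure hG1 fun ω hω => by rw [twoPort_mem_X3_far L hsL hvL huL (hωG ω hω) hcL, Set.mem_union]
  have m4 : (prodBernoulli w1).real X3 = (prodBernoulli w0).real (SBc ∪ NBuc ∪ NBxc) := by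
    rw [lift]
    exact real_congr_of_sure hG1 fun ω hω => by
      rw [Set.mem_preimage, twoPort_lift_X3_far L hsL hvL hxL huL (hωG ω hω) hcL, Set.mem_union, Set.mem_union, or_assoc]
  have m5 : (prodBernoulli w0).real (U ∩ X3) = 0 :=
    zero_of_empty fun ω hω h => twoPort_mem_U_far L hsL hvL (hωG ω hω) hbL h.1
  have m6 : (prodBernoulli w1).real (U ∩ X3)
      = (prodBernoulli w0).real (Set.univ \ SAv) * (prodBernoulli w0).real ((SBu \ SBx) ∩ NBbx ∩ (SBc ∪ NBuc ∪ NBxc)) := by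
    rw [lift, ← indep hAv (hinter hU'b hC1)]
    refine real_congr_of_sure hG1 fun ω hω => ?_
    rw [Set.mem_preimage, Set.mem_inter_iff, twoPort_lift_U_far L hsL hvL hxL huL (hωG ω hω) hbL,
      twoPort_lift_X3_far L hsL hvL hxL huL (hωG ω hω) hcL]
    simp only [Set.mem_inter_iff, Set.mem_sdiff, Set.mem_union, Set.mem_univ, true_and]
    tauto
  have m7 : (prodBernoulli w0).real (U ∩ X2) = 0 :=
    zero_of_empty fun ω hω h => twoPort_mem_U_far L hsL hvL (hωG ω hω) hbL h.1
  have m8 : (prodBernoulli w1).real (U ∩ X2)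
      = (prodBernoulli w0).real (Set.univ \ SAv) * (prodBernoulli w0).real ((SBu \ SBx) ∩ NBbx ∩ (SBc ∪ NBuc)) := by
    rw [lift, ← indep hAv (hinter hU'b hC0)]
    refine real_congr_of_sure hG1 fun ω hω => ?_
    rw [Set.mem_preimage, Set.mem_inter_iff]
    constructor
    · rintro ⟨hU, hX⟩
      rw [twoPort_lift_X2_far L hsL hvL hxL huL (hωG ω hω) hcL hU] at hX
      rw [twoPort_lift_U_far L hsL hvL hxL huL (hωG ω hω) hbL] at hU
      simp only [Set.mem_inter_iff, Set.mem_sdiff, Set.mem_union, Set.mem_univ, true_and]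
      tauto
    · intro h
      simp only [Set.mem_inter_iff, Set.mem_sdiff, Set.mem_union, Set.mem_univ, true_and] at h
      have hU : insert e ω ∈ U := by
        rw [twoPort_lift_U_far L hsL hvL hxL huL (hωG ω hω) hbL]; tauto
      rw [twoPort_lift_X2_far L hsL hvL hxL huL (hωG ω hω) hcL hU]
      exact ⟨hU, h.2.2⟩
  -- (3) the induction instance `(u, x'; b, c)` in block form (all far)
  have hs2 : s ∈ Lᶜ := hsL
  have hx2 : x' ∈ Lᶜ := hxL
  have hu2 : u ∈ Lᶜ := huL
  have hc2 : c ∈ Lᶜ := hcL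
  have hb2 : b ∈ Lᶜ := hbL
  have cU : ∀ ω ∈ G, (ω ∈ openConn s u ∩ (openConn s x')ᶜ ∩ openConn b x' ↔ ω ∈ (SBu \ SBx) ∩ NBbx) := fun ω hω => by
    rw [Set.mem_inter_iff, Set.mem_inter_iff, Set.mem_compl_iff, Set.mem_inter_iff, Set.mem_sdiff,
      bridge_conn_rr L hsL (hωG ω hω) hs2 hu2, bridge_conn_rr L hsL (hωG ω hω) hs2 hx2, bridge_conn_rr L hsL (hωG ω hω) hb2 hx2]
  have cX3 : ∀ ω ∈ G, (ω ∈ openConn s c ∪ openConn u c ∪ openConn x' c ↔ ω ∈ SBc ∪ NBuc ∪ NBxc) := fun ω hω => by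
    rw [Set.mem_union, Set.mem_union, Set.mem_union, Set.mem_union, bridge_conn_rr L hsL (hωG ω hω) hs2 hc2,
      bridge_conn_rr L hsL (hωG ω hω) hu2 hc2, bridge_conn_rr L hsL (hωG ω hω) hx2 hc2]
  have cX2 : ∀ ω ∈ G, (ω ∈ openConn s c ∪ openConn u c ↔ ω ∈ SBc ∪ NBuc) := fun ω hω => by
    rw [Set.mem_union, Set.mem_union, bridge_conn_rr L hsL (hωG ω hω) hs2 hc2, bridge_conn_rr L hsL (hωG ω hω) hu2 hc2]
  have i1 : (prodBernoulli w0).real (openConn s u ∩ (openConn s x')ᶜ ∩ openConn b x')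
      = (prodBernoulli w0).real ((SBu \ SBx) ∩ NBbx) := real_congr_of_sure hG1 cU
  have i2 : (prodBernoulli w0).real (openConn s c ∪ openConn u c ∪ openConn x' c)
      = (prodBernoulli w0).real (SBc ∪ NBuc ∪ NBxc) := real_congr_of_sure hG1 cX3
  have i3 : (prodBernoulli w0).real (openConn s u ∩ (openConn s x')ᶜ ∩ openConn b x' ∩ (openConn s c ∪ openConn u c ∪ openConn x' c))
      = (prodBernoulli w0).real ((SBu \ SBx) ∩ NBbx ∩ (SBc ∪ NBuc ∪ NBxc)) :=
    real_congr_of_sure hG1 fun ω hω => by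
      rw [Set.mem_inter_iff, cU ω hω, cX3 ω hω]; simp only [Set.mem_inter_iff]
  have i4 : (prodBernoulli w0).real (openConn s u ∩ (openConn s x')ᶜ ∩ openConn b x' ∩ (openConn s c ∪ openConn u c))
      = (prodBernoulli w0).real ((SBu \ SBx) ∩ NBbx ∩ (SBc ∪ NBuc)) :=
    real_congr_of_sure hG1 fun ω hω => by
      rw [Set.mem_inter_iff, cU ω hω, cX2 ω hω]; simp only [Set.mem_inter_iff]
  have IH' := IH
  rw [i1, i2, i3, i4] at IH'
  have hX : (prodBernoulli w0).real (SBc ∪ NBuc) ≤ (prodBernoulli w0).real (SBc ∪ NBuc ∪ NBxc) :=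
    measureReal_mono Set.subset_union_left (measure_ne_top _ _)
  -- (4) assemble
  rw [ob U, ob X3, ob (U ∩ X3), ob (U ∩ X2), m1, m2, m3, m4, m5, m6, m7, m8]
  have hp0 : (0 : ℝ) ≤ w e := (w e).2.1
  have hp1 : (w e : ℝ) ≤ 1 := (w e).2.2
  have hA : 0 ≤ (prodBernoulli w0).real (Set.univ \ SAv) := measureReal_nonneg
  have hUb : 0 ≤ (prodBernoulli w0).real ((SBu \ SBx) ∩ NBbx) := measureReal_nonneg
  have hC0n : 0 ≤ (prodBernoulli w0).real (SBc ∪ NBuc) := measureReal_nonneg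
  have key := mul_le_mul_of_nonneg_left IH' (mul_nonneg hp0 hA)
  have mono : (1 - (w e : ℝ)) * (prodBernoulli w0).real (SBc ∪ NBuc) + (w e : ℝ) * (prodBernoulli w0).real (SBc ∪ NBuc ∪ NBxc)
      ≤ (prodBernoulli w0).real (SBc ∪ NBuc ∪ NBxc) := by nlinarith
  have key2 := mul_le_mul_of_nonneg_left (mul_le_mul_of_nonneg_left mono hUb) (mul_nonneg hp0 hA)
  have e1 : ((1 - (w e : ℝ)) * 0 + (w e : ℝ) * ((prodBernoulli w0).real (Set.univ \ SAv) * (prodBernoulli w0).real ((SBu \ SBx) ∩ NBbx)))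
      * ((1 - (w e : ℝ)) * (prodBernoulli w0).real (SBc ∪ NBuc) + (w e : ℝ) * (prodBernoulli w0).real (SBc ∪ NBuc ∪ NBxc))
      = (w e : ℝ) * (prodBernoulli w0).real (Set.univ \ SAv) * ((prodBernoulli w0).real ((SBu \ SBx) ∩ NBbx)
        * ((1 - (w e : ℝ)) * (prodBernoulli w0).real (SBc ∪ NBuc) + (w e : ℝ) * (prodBernoulli w0).real (SBc ∪ NBuc ∪ NBxc))) := by
    ring
  have e2 : ((1 - (w e : ℝ)) * 0 + (w e : ℝ) * ((prodBernoulli w0).real (Set.univ \ SAv)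
        * (prodBernoulli w0).real ((SBu \ SBx) ∩ NBbx ∩ (SBc ∪ NBuc ∪ NBxc))))
      + ((1 - (w e : ℝ)) * 0 + (w e : ℝ) * ((prodBernoulli w0).real (Set.univ \ SAv)
        * (prodBernoulli w0).real ((SBu \ SBx) ∩ NBbx ∩ (SBc ∪ NBuc))))
      = (w e : ℝ) * (prodBernoulli w0).real (Set.univ \ SAv) * ((prodBernoulli w0).real ((SBu \ SBx) ∩ NBbx ∩ (SBc ∪ NBuc ∪ NBxc))
        + (prodBernoulli w0).real ((SBu \ SBx) ∩ NBbx ∩ (SBc ∪ NBuc))) := by ring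
  rw [e1, e2]
  exact le_trans key2 key

end IncStar

end Summit.CriticalPhenomena.PercolationContinuityZ3.Theorems
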